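import Summits.NavierStokesRegularity.NavierStokesRegularity.Theorems.PerpetualPumpAveragedTypeIBlowupPulseTools

/-!
# Crux `PerpetualPump.AveragedTypeIBlowup` (stmt-NavierStokesRegularity-1835), line `Sketch`:
# tools for the stub `pulse`, II — the quadratic invariants and the radius of the gate

Second layer of the proof of the registered stub `stub_pulse` (the TRANSFER PULSE of the forced
Toda gate `b' = -b - w² + f₁`, `w' = w(b - β - 1) + f₂`, `β' = -q⁴β + w² + f₃`, `|fᵢ| ≤ φ ≤ 1/2000`,
`B ≥ 10⁴`, `q⁴ ∈ [1, 1.11]`), continuing `…PulseTools.lean`.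

* `pulse_envelope_quad` — on the whole window the quadratic quantities `J = 2bβ - w²` and
  `L = J + (q⁴-1)β` obey `J ≤ 3B/100`, `L ∈ [-(B/20 + 1/100), 27B/500]`: both solve damped linear
  equations `J' = -(1+q⁴)J + (1-q⁴)w² + Φ`, `L' = -(1+q⁴)L + (q⁴-1)β + Φ + (q⁴-1)f₃` whose sources are
  signed or pointwise bounded, so barriers apply (no integral of `w²` is ever needed). Since
  `P² - R² = 2J` (`P = b + β`, `R² = (b-β)² + 2w²`), this controls `(P - R)/2 = J/(P+R)`, hence the
  old carrier `b = (P-R)/2 + R(1+u)/2` at the end of the pulse.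
* `pulse_gate_point`, `pulse_gate_derivs`, `pulse_alg_state` — the gate at one point in the clock
  coordinates `R = √((b-β)² + 2w²)`, `u = (b-β)/R` (from the landed `stub_gateAlgebra`).
* `pulse_gate_radius` (= registered sub-goal `stub_pulseGate`) — the GATE PHASE, radius part: as
  long as `w ≥ 1` on `[0, T]`, `B T ≤ 5 log B + 20`, the functions `R`, `u` are continuous on
  `[0, T]` and differentiable inside with `|R' + R| ≤ 0.1101 B` and the raw logistic inequality
  for `u'`, and the radius stays in `[0.99 B, 1.001 B]`, `R ≥ B - 1/50 - 1.1111 B σ`.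

## References

Folklore ODE comparison arguments; the gate is the Toda-type transfer step of T. Tao, *Finite time
blowup for an averaged three-dimensional Navier–Stokes equation*, J. Amer. Math. Soc. 29 (2016),
601–674, §5.4–5.5.
-/

noncomputable section

-- the summit namespace `…NavierStokesRegularity.NavierStokesRegularity…` is the tree convention
set_option linter.dupNamespace false

open Set Filter Topology

namespace Summit.NavierStokesRegularity.NavierStokesRegularity.Theorems.PerpetualPumpAveragedTypeIBlowup

/-- **A-priori envelopes of the transfer pulse, II: the quadratic quantities.** With the bounds of
part I, the quantities `J = 2bβ - w²` and `L = J + (q⁴-1)β` satisfy `J ≤ 3B/100`,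
`L ∈ [-(B/20 + 1/100), 27B/500]` on `[0, σ₁]` (barriers for
`J' = -(1+q⁴)J + (1-q⁴)w² + Φ`, `L' = -(1+q⁴)L + (q⁴-1)β + Φ + (q⁴-1)f₃`,
`Φ = 2βf₁ + 2bf₃ - 2wf₂`). [folklore] -/
theorem pulse_envelope_quad (b w β f₁ f₂ f₃ : ℝ → ℝ) (B q4 φ σ₁ : ℝ)
    (hB : 10 ^ 4 ≤ B) (hq1 : 1 ≤ q4) (hq2 : q4 ≤ 111 / 100) (hφ1 : φ ≤ 1 / 2000)
    (hbc : ContinuousOn b (Icc 0 σ₁)) (hwc : ContinuousOn w (Icc 0 σ₁))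
    (hβc : ContinuousOn β (Icc 0 σ₁))
    (hbd : ∀ σ ∈ Ioo 0 σ₁, HasDerivAt b (-(b σ) - (w σ) ^ 2 + f₁ σ) σ)
    (hwd : ∀ σ ∈ Ioo 0 σ₁, HasDerivAt w (w σ * (b σ - β σ - 1) + f₂ σ) σ)
    (hβd : ∀ σ ∈ Ioo 0 σ₁, HasDerivAt β (-(q4 * β σ) + (w σ) ^ 2 + f₃ σ) σ)
    (hf : ∀ σ ∈ Icc 0 σ₁, |f₁ σ| ≤ φ ∧ |f₂ σ| ≤ φ ∧ |f₃ σ| ≤ φ)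
    (hb0 : b 0 = B) (hw0 : w 0 = Real.sqrt B / 10) (hβ0 : |β 0| ≤ 1 / 50)
    (henv : ∀ σ ∈ Icc 0 σ₁,
      |b σ| ≤ B + 1 / 100 ∧ |w σ| ≤ B + 1 / 100 ∧ |β σ| ≤ B + 1 / 100 ∧ -(1 / 50) ≤ β σ) :
    ∀ σ ∈ Icc 0 σ₁,
      2 * b σ * β σ - (w σ) ^ 2 ≤ 3 * B / 100 ∧
      -(B / 20 + 1 / 100) ≤ 2 * b σ * β σ - (w σ) ^ 2 + (q4 - 1) * β σ ∧
      2 * b σ * β σ - (w σ) ^ 2 + (q4 - 1) * β σ ≤ 27 * B / 500 := by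
  have hB0 : 0 < B := lt_of_lt_of_le (by norm_num) hB
  have hw0sq : w 0 ^ 2 = B / 100 := by
    rw [hw0, div_pow, Real.sq_sqrt hB0.le]; norm_num
  have hβ0' := abs_le.1 hβ0
  have hBφ : B * φ ≤ B * (1 / 2000) := mul_le_mul_of_nonneg_left hφ1 hB0.le
  have hqφ : (q4 - 1) * φ ≤ (q4 - 1) * (1 / 2000) := mul_le_mul_of_nonneg_left hφ1 (by linarith)
  have hqB : q4 * B ≤ 111 / 100 * B := mul_le_mul_of_nonneg_right hq2 hB0.le
  have hqB' : 1 * B ≤ q4 * B := mul_le_mul_of_nonneg_right hq1 hB0.le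
  have hJd : ∀ s ∈ Ioo 0 σ₁, HasDerivAt (fun s => 2 * b s * β s - (w s) ^ 2)
      (-(1 + q4) * (2 * b s * β s - (w s) ^ 2) + (1 - q4) * (w s) ^ 2 +
        (2 * β s * f₁ s + 2 * b s * f₃ s - 2 * w s * f₂ s)) s := fun s hs =>
    ((((hbd s hs).const_mul 2).mul (hβd s hs)).sub (gateAlgebra_hasDerivAt_sq (hwd s hs))).congr_deriv
      (by ring)
  have hΦ : ∀ s ∈ Ioo 0 σ₁, |2 * β s * f₁ s + 2 * b s * f₃ s - 2 * w s * f₂ s| ≤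
      3 * (2 * (B + 1 / 100) * φ) := by
    intro s hs
    obtain ⟨h1, h2, h3⟩ := hf s (Ioo_subset_Icc_self hs)
    obtain ⟨hb', hw', hβ', -⟩ := henv s (Ioo_subset_Icc_self hs)
    have := pulse_alg_forcing hβ' h1
    have := pulse_alg_forcing hb' h3
    have := pulse_alg_forcing hw' h2
    rw [abs_le]; constructor <;> linarith
  have hJhi : ∀ σ ∈ Icc 0 σ₁, 2 * b σ * β σ - (w σ) ^ 2 ≤ 3 * B / 100 := by
    refine pulse_barrier_upper (x := fun s => 2 * b s * β s - (w s) ^ 2)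
      (((hbc.const_mul 2).mul hβc).sub (hwc.pow 2))
      (show 2 * b 0 * β 0 - (w 0) ^ 2 ≤ 3 * B / 100 by rw [hb0, hw0sq]; nlinarith)
      (fun s hs (hlt : 3 * B / 100 < 2 * b s * β s - (w s) ^ 2) => ⟨_, hJd s hs, ?_⟩)
    have hΦs := (abs_le.1 (hΦ s hs)).2
    have e1 : (1 - q4) * (w s) ^ 2 ≤ 0 :=
      mul_nonpos_of_nonpos_of_nonneg (by linarith) (sq_nonneg _)
    have e2 : (1 + q4) * (3 * B / 100) ≤ (1 + q4) * (2 * b s * β s - (w s) ^ 2) :=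
      mul_le_mul_of_nonneg_left hlt.le (by linarith)
    linarith
  have hLd : ∀ s ∈ Ioo 0 σ₁, HasDerivAt (fun s => 2 * b s * β s - (w s) ^ 2 + (q4 - 1) * β s)
      (-(1 + q4) * (2 * b s * β s - (w s) ^ 2 + (q4 - 1) * β s) + (q4 - 1) * β s +
        (2 * β s * f₁ s + 2 * b s * f₃ s - 2 * w s * f₂ s) + (q4 - 1) * f₃ s) s := fun s hs =>
    ((hJd s hs).add ((hβd s hs).const_mul (q4 - 1))).congr_deriv (by ring)
  have hLc : ContinuousOn (fun s => 2 * b s * β s - (w s) ^ 2 + (q4 - 1) * β s) (Icc 0 σ₁) :=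
    (((hbc.const_mul 2).mul hβc).sub (hwc.pow 2)).add (hβc.const_mul _)
  have hL0 : 2 * b 0 * β 0 - (w 0) ^ 2 + (q4 - 1) * β 0 = (2 * B + (q4 - 1)) * β 0 - B / 100 := by
    rw [hb0, hw0sq]; ring
  have hLlo : ∀ σ ∈ Icc 0 σ₁, -(B / 20 + 1 / 100) ≤ 2 * b σ * β σ - (w σ) ^ 2 + (q4 - 1) * β σ := by
    refine pulse_barrier_lower hLc ?_
      (fun s hs (hlt : 2 * b s * β s - (w s) ^ 2 + (q4 - 1) * β s < -(B / 20 + 1 / 100)) =>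
        ⟨_, hLd s hs, ?_⟩)
    · rw [hL0]
      have : (2 * B + (q4 - 1)) * (-(1 / 50)) ≤ (2 * B + (q4 - 1)) * β 0 :=
        mul_le_mul_of_nonneg_left hβ0'.1 (by linarith)
      linarith
    · obtain ⟨-, -, h3⟩ := hf s (Ioo_subset_Icc_self hs)
      have h3' := (abs_le.1 h3).1
      have hΦs := (abs_le.1 (hΦ s hs)).1
      obtain ⟨-, -, -, hβs⟩ := henv s (Ioo_subset_Icc_self hs)
      have e1 : (q4 - 1) * (-(1 / 50)) ≤ (q4 - 1) * β s :=
        mul_le_mul_of_nonneg_left hβs (by linarith)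
      have e2 : (1 + q4) * (B / 20 + 1 / 100) ≤
          (1 + q4) * (-(2 * b s * β s - (w s) ^ 2 + (q4 - 1) * β s)) :=
        mul_le_mul_of_nonneg_left (by linarith) (by linarith)
      have e3 : (q4 - 1) * (-φ) ≤ (q4 - 1) * f₃ s := mul_le_mul_of_nonneg_left h3' (by linarith)
      linarith
  have hLhi : ∀ σ ∈ Icc 0 σ₁, 2 * b σ * β σ - (w σ) ^ 2 + (q4 - 1) * β σ ≤ 27 * B / 500 := by
    refine pulse_barrier_upper hLc ?_
      (fun s hs (hlt : 27 * B / 500 < 2 * b s * β s - (w s) ^ 2 + (q4 - 1) * β s) =>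
        ⟨_, hLd s hs, ?_⟩)
    · rw [hL0]
      have : (2 * B + (q4 - 1)) * β 0 ≤ (2 * B + (q4 - 1)) * (1 / 50) :=
        mul_le_mul_of_nonneg_left hβ0'.2 (by linarith)
      linarith
    · obtain ⟨-, -, h3⟩ := hf s (Ioo_subset_Icc_self hs)
      have h3' := (abs_le.1 h3).2
      have hΦs := (abs_le.1 (hΦ s hs)).2
      obtain ⟨-, -, hβa, -⟩ := henv s (Ioo_subset_Icc_self hs)
      have hβs := (abs_le.1 hβa).2
      have e1 : (q4 - 1) * β s ≤ (q4 - 1) * (B + 1 / 100) :=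
        mul_le_mul_of_nonneg_left hβs (by linarith)
      have e2 : (1 + q4) * (27 * B / 500) ≤
          (1 + q4) * (2 * b s * β s - (w s) ^ 2 + (q4 - 1) * β s) :=
        mul_le_mul_of_nonneg_left hlt.le (by linarith)
      have e3 : (q4 - 1) * f₃ s ≤ (q4 - 1) * φ := mul_le_mul_of_nonneg_left h3' (by linarith)
      linarith
  intro σ hσ
  exact ⟨hJhi σ hσ, hLlo σ hσ, hLhi σ hσ⟩


/-- **Gate coordinates at one point.** With `0 < w`, `R = √((b-β)² + 2w²)` and `u = (b-β)/R`:
`R > 0`, `R² = (b-β)² + 2w²`, `b - β = uR`, `|u| ≤ 1`, `2w² = R²(1-u²)` and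
`(P - R)(P + R) = 2J` for `P = b + β`, `J = 2bβ - w²`. [folklore] -/
theorem pulse_gate_point {b β w R u : ℝ} (hw : 0 < w)
    (hR : Real.sqrt ((b - β) ^ 2 + 2 * w ^ 2) = R) (hu : u = (b - β) / R) :
    0 < R ∧ R ^ 2 = (b - β) ^ 2 + 2 * w ^ 2 ∧ b - β = u * R ∧ -1 ≤ u ∧ u ≤ 1 ∧
      2 * w ^ 2 = R ^ 2 * (1 - u ^ 2) ∧ (b + β - R) * (b + β + R) = 2 * (2 * b * β - w ^ 2) := by
  obtain ⟨hR0, hR2, hDR, -⟩ := gateAlgebra_radius_facts hw hR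
  have hD : b - β = u * R := by rw [hu]; field_simp
  have hu1 : |u| ≤ 1 := by
    rw [hu, abs_div, abs_of_pos hR0, div_le_one hR0]; exact hDR
  refine ⟨hR0, hR2, hD, (abs_le.1 hu1).1, (abs_le.1 hu1).2, ?_, ?_⟩
  · have : (b - β) ^ 2 = u ^ 2 * R ^ 2 := by rw [hD]; ring
    nlinarith
  · nlinarith

/-- **Gate derivatives at one point** (`stub_gateAlgebra`, restated for named radius and clock
functions `R`, `u`): at a point where the three gate equations hold and `w > 0`, `R` has a derivative
`R'` with `|R' + R| ≤ (q⁴-1)|β| + |f₁| + |f₃| + √2|f₂|`, and `u` has a derivative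
`u' ≤ -(R - |g₁|/R)(1 - u²) + √2|f₂|/R`, `|g₁| ≤ (q⁴-1)|β| + |f₁| + |f₃|`. [folklore] -/
theorem pulse_gate_derivs {b w β R u : ℝ → ℝ} {q4 f₁ f₂ f₃ σ : ℝ} (hq1 : 1 ≤ q4)
    (hb : HasDerivAt b (-(b σ) - (w σ) ^ 2 + f₁) σ)
    (hw : HasDerivAt w (w σ * (b σ - β σ - 1) + f₂) σ)
    (hβ : HasDerivAt β (-(q4 * β σ) + (w σ) ^ 2 + f₃) σ) (hwpos : 0 < w σ)
    (hR : R = fun s => Real.sqrt ((b s - β s) ^ 2 + 2 * (w s) ^ 2))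
    (hu : u = fun s => (b s - β s) / R s) :
    (∃ R' : ℝ, HasDerivAt R R' σ ∧
      |R' + R σ| ≤ (q4 - 1) * |β σ| + |f₁| + |f₃| + Real.sqrt 2 * |f₂|) ∧
    (∃ u' g : ℝ, HasDerivAt u u' σ ∧ |g| ≤ (q4 - 1) * |β σ| + |f₁| + |f₃| ∧
      u' ≤ -(R σ - |g| / R σ) * (1 - (u σ) ^ 2) + Real.sqrt 2 * |f₂| / R σ) := by
  obtain ⟨-, -, ⟨R', hR', hRb⟩, ⟨u', hu', hub⟩⟩ := stub_gateAlgebra b w β q4 f₁ f₂ f₃ σ hb hw hβ hwpos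
  have hg : |(q4 - 1) * β σ + f₁ - f₃| ≤ (q4 - 1) * |β σ| + |f₁| + |f₃| := by
    calc |(q4 - 1) * β σ + f₁ - f₃| ≤ |(q4 - 1) * β σ + f₁| + |f₃| := abs_sub _ _
      _ ≤ |(q4 - 1) * β σ| + |f₁| + |f₃| := by linarith [abs_add_le ((q4 - 1) * β σ) f₁]
      _ = (q4 - 1) * |β σ| + |f₁| + |f₃| := by rw [abs_mul, abs_of_nonneg (by linarith)]
  subst hR hu
  exact ⟨⟨R', hR', hRb.trans (by linarith)⟩, ⟨u', _, hu', hg, hub⟩⟩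


/-- **State of the gate in clock coordinates.** With `R > 0`, `R ≤ 1.001 B`, `b - β = uR`,
`|u| ≤ 1`, `2w² = R²(1-u²)`, `(P-R)/2 ∈ [-43/500, 33/2000]`, `β ≥ -1/50`:
`b = (P-R)/2 + R(1+u)/2 ≥ -43/500`, `|β| ≤ 1/50 + (1001 B/2000)(1 - u)` and `|w| ≤ 0.71 B`.
[folklore] -/
theorem pulse_alg_state {b β w R u B : ℝ} (hB : 10 ^ 4 ≤ B) (hRpos : 0 < R)
    (hRhi : R ≤ 1001 / 1000 * B) (hD : b - β = u * R) (hu1 : -1 ≤ u) (hu2 : u ≤ 1)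
    (hw2 : 2 * w ^ 2 = R ^ 2 * (1 - u ^ 2)) (hXlo : -(43 / 500) ≤ (b + β - R) / 2)
    (hXhi : (b + β - R) / 2 ≤ 33 / 2000) (hβlo : -(1 / 50) ≤ β) :
    -(43 / 500) ≤ b ∧ |β| ≤ 1 / 50 + 1001 / 2000 * B * (1 - u) ∧ |w| ≤ 71 / 100 * B := by
  have hB0 : 0 < B := lt_of_lt_of_le (by norm_num) hB
  have hRu : 0 ≤ R * (1 + u) := mul_nonneg hRpos.le (by linarith)
  have hRu' : R * (1 - u) ≤ 1001 / 1000 * B * (1 - u) :=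
    mul_le_mul_of_nonneg_right hRhi (by linarith)
  have hb : b = (b + β - R) / 2 + R * (1 + u) / 2 := by linarith
  have hβ : β = (b + β - R) / 2 + R * (1 - u) / 2 := by linarith
  refine ⟨by linarith, ?_, ?_⟩
  · rw [abs_le]
    constructor
    · nlinarith
    · linarith
  · refine abs_le_of_sq_le_sq ?_ (by positivity)
    have : R ^ 2 ≤ (1001 / 1000 * B) ^ 2 := pow_le_pow_left₀ hRpos.le hRhi 2
    nlinarith [sq_nonneg u]

/-- **The gate phase, I: radius.** Suppose `w ≥ 1` on `[0, T]`, `0 < T ≤ σ₁`, `B T ≤ 5 log B + 20`.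
Then on `[0, T]` the radius `R = √((b-β)² + 2w²)` and the clock `u = (b-β)/R` are continuous and
differentiable inside with `|R' + R| ≤ 0.1101 B` and the raw logistic inequality for `u'`, and
`R ∈ [0.99 B, 1.001 B]`, `R ≥ B - 1/50 - 1.1111 B σ` (barrier for `R - 0.1101 B t`, mean value
inequality). [folklore] -/
theorem pulse_gate_radius (b w β f₁ f₂ f₃ R u : ℝ → ℝ) (B q4 φ σ₁ T : ℝ)
    (hB : 10 ^ 4 ≤ B) (hq1 : 1 ≤ q4) (hq2 : q4 ≤ 111 / 100) (hφ0 : 0 ≤ φ) (hφ1 : φ ≤ 1 / 2000)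
    (hσ₁ : σ₁ ≤ 1 / 10)
    (hbc : ContinuousOn b (Icc 0 σ₁)) (hwc : ContinuousOn w (Icc 0 σ₁))
    (hβc : ContinuousOn β (Icc 0 σ₁))
    (hbd : ∀ σ ∈ Ioo 0 σ₁, HasDerivAt b (-(b σ) - (w σ) ^ 2 + f₁ σ) σ)
    (hwd : ∀ σ ∈ Ioo 0 σ₁, HasDerivAt w (w σ * (b σ - β σ - 1) + f₂ σ) σ)
    (hβd : ∀ σ ∈ Ioo 0 σ₁, HasDerivAt β (-(q4 * β σ) + (w σ) ^ 2 + f₃ σ) σ)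
    (hf : ∀ σ ∈ Icc 0 σ₁, |f₁ σ| ≤ φ ∧ |f₂ σ| ≤ φ ∧ |f₃ σ| ≤ φ)
    (hb0 : b 0 = B) (hw0 : w 0 = Real.sqrt B / 10) (hβ0 : |β 0| ≤ 1 / 50)
    (hR : R = fun s => Real.sqrt ((b s - β s) ^ 2 + 2 * (w s) ^ 2))
    (hu : u = fun s => (b s - β s) / R s)
    (hT0 : 0 < T) (hT1 : T ≤ σ₁) (hTB : B * T ≤ 5 * Real.log B + 20)
    (hw1 : ∀ σ ∈ Icc 0 T, 1 ≤ w σ) :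
    ContinuousOn R (Icc 0 T) ∧ ContinuousOn u (Icc 0 T) ∧
    (∀ s ∈ Ioo 0 T,
      (∃ R' : ℝ, HasDerivAt R R' s ∧ |R' + R s| ≤ 1101 / 10000 * B) ∧
      (∃ u' g : ℝ, HasDerivAt u u' s ∧ |g| ≤ 1101 / 10000 * B ∧
        u' ≤ -(R s - |g| / R s) * (1 - (u s) ^ 2) + Real.sqrt 2 * |f₂ s| / R s)) ∧
    ∀ σ ∈ Icc 0 T, 99 / 100 * B ≤ R σ ∧ R σ ≤ 1001 / 1000 * B ∧
      B - 1 / 50 - 11111 / 10000 * B * σ ≤ R σ := by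
  have hB0 : 0 < B := lt_of_lt_of_le (by norm_num) hB
  have hlog := pulse_log_le hB
  have hw0sq : w 0 ^ 2 = B / 100 := by
    rw [hw0, div_pow, Real.sq_sqrt hB0.le]; norm_num
  have hs2 : Real.sqrt 2 ≤ 3 / 2 := by
    rw [Real.sqrt_le_left (by norm_num)]; norm_num
  have henv := pulse_envelope_energy b w β f₁ f₂ f₃ B q4 φ σ₁ hB hq1 hq2 hφ0 hφ1 hσ₁ hbc hwc hβc
    hbd hwd hβd hf hb0 hw0 hβ0
  have hTI : Icc 0 T ⊆ Icc 0 σ₁ := Icc_subset_Icc_right hT1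
  have hRs : ∀ s, Real.sqrt ((b s - β s) ^ 2 + 2 * (w s) ^ 2) = R s := fun s => by rw [hR]
  have hus : ∀ s, u s = (b s - β s) / R s := fun s => by rw [hu]
  have hpt : ∀ s ∈ Icc 0 T, 0 < R s ∧ R s ^ 2 = (b s - β s) ^ 2 + 2 * (w s) ^ 2 ∧
      b s - β s = u s * R s ∧ -1 ≤ u s ∧ u s ≤ 1 ∧ 2 * (w s) ^ 2 = R s ^ 2 * (1 - (u s) ^ 2) ∧
      (b s + β s - R s) * (b s + β s + R s) = 2 * (2 * b s * β s - (w s) ^ 2) := fun s hs =>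
    pulse_gate_point (by linarith [hw1 s hs]) (hRs s) (hus s)
  -- continuity
  have hbT := hbc.mono hTI
  have hβT := hβc.mono hTI
  have hwT := hwc.mono hTI
  have hRc : ContinuousOn R (Icc 0 T) := by
    have h : ContinuousOn (fun s => (b s - β s) ^ 2 + 2 * (w s) ^ 2) (Icc 0 T) :=
      ((hbT.sub hβT).pow 2).add ((hwT.pow 2).const_mul 2)
    rw [hR]
    exact h.sqrt
  have huc : ContinuousOn u (Icc 0 T) := by
    rw [hu]
    exact (hbT.sub hβT).div hRc fun s hs => (hpt s hs).1.ne'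
  -- derivatives inside
  have hder : ∀ s ∈ Ioo 0 T,
      (∃ R' : ℝ, HasDerivAt R R' s ∧ |R' + R s| ≤ 1101 / 10000 * B) ∧
      (∃ u' g : ℝ, HasDerivAt u u' s ∧ |g| ≤ 1101 / 10000 * B ∧
        u' ≤ -(R s - |g| / R s) * (1 - (u s) ^ 2) + Real.sqrt 2 * |f₂ s| / R s) := by
    intro s hs
    have hs' : s ∈ Ioo 0 σ₁ := ⟨hs.1, hs.2.trans_le hT1⟩
    obtain ⟨⟨R', hR', hRb⟩, ⟨u', g, hu', hg, hub⟩⟩ := pulse_gate_derivs hq1 (hbd s hs') (hwd s hs')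
      (hβd s hs') (by linarith [hw1 s (Ioo_subset_Icc_self hs)]) hR hu
    obtain ⟨h1, h2, h3⟩ := hf s (Ioo_subset_Icc_self hs')
    obtain ⟨-, -, hβa, -⟩ := henv s (Ioo_subset_Icc_self hs')
    have e1 : (q4 - 1) * |β s| ≤ (q4 - 1) * (B + 1 / 100) :=
      mul_le_mul_of_nonneg_left hβa (by linarith)
    have e2 : Real.sqrt 2 * |f₂ s| ≤ 3 / 2 * φ :=
      mul_le_mul hs2 h2 (abs_nonneg _) (by norm_num)
    have e3 : q4 * B ≤ 111 / 100 * B := mul_le_mul_of_nonneg_right hq2 hB0.le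
    exact ⟨⟨R', hR', hRb.trans (by linarith)⟩, ⟨u', g, hu', hg.trans (by linarith), hub⟩⟩
  -- the radius at time `0`
  obtain ⟨hR0lo, hR0hi, -⟩ : B - 1 / 50 ≤ R 0 ∧ R 0 ≤ B + 3 / 100 ∧ u 0 ≤ 1 - 1 / (101 * B) := by
    obtain ⟨hR0pos, hR0sq, hD0, -⟩ := hpt 0 (left_mem_Icc.2 hT0.le)
    rw [hb0, hw0sq] at hR0sq
    rw [hb0] at hD0
    exact pulse_alg_u0 hB hβ0 hR0pos hR0sq hD0
  -- upper bound for `R`: barrier for `R - G t`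
  have hRhi' : ∀ σ ∈ Icc 0 T, R σ - 1101 / 10000 * B * σ ≤ B + 3 / 100 := by
    refine pulse_barrier_upper (x := fun s => R s - 1101 / 10000 * B * s)
      (hRc.sub (by fun_prop)) (show R 0 - 1101 / 10000 * B * 0 ≤ B + 3 / 100 by linarith)
      (fun s hs (hlt : B + 3 / 100 < R s - 1101 / 10000 * B * s) => ?_)
    obtain ⟨⟨R', hR', hRb⟩, -⟩ := hder s hs
    refine ⟨_, hR'.sub ((hasDerivAt_id s).const_mul (1101 / 10000 * B)), ?_⟩
    have := (abs_le.1 hRb).2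
    simp only [mul_one]
    nlinarith [hs.1.le]
  have hRhi : ∀ σ ∈ Icc 0 T, R σ ≤ 1001 / 1000 * B := by
    intro σ hσ
    have h1 := hRhi' σ hσ
    have h2 : 1101 / 10000 * B * σ ≤ 1101 / 10000 * (B * T) := by nlinarith [hσ.1, hσ.2]
    nlinarith
  -- lower bound for `R`: mean value inequality
  have hRlo : ∀ σ ∈ Icc 0 T, B - 1 / 50 - 11111 / 10000 * B * σ ≤ R σ := by
    intro σ hσ
    have key := pulse_image_sub_ge (f := R) (C := -(11111 / 10000 * B)) hσ.1
      (hRc.mono (Icc_subset_Icc_right hσ.2)) (fun s hs => by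
        have hs' : s ∈ Ioo 0 T := ⟨hs.1, hs.2.trans_le hσ.2⟩
        obtain ⟨⟨R', hR', hRb⟩, -⟩ := hder s hs'
        have := (abs_le.1 hRb).1
        exact ⟨R', hR', by linarith [hRhi s (Ioo_subset_Icc_self hs')]⟩)
    linarith
  have hR99 : ∀ σ ∈ Icc 0 T, 99 / 100 * B ≤ R σ := by
    intro σ hσ
    have h1 := hRlo σ hσ
    have h2 : 11111 / 10000 * B * σ ≤ 11111 / 10000 * (B * T) := by nlinarith [hσ.1, hσ.2]
    nlinarith
  exact ⟨hRc, huc, hder, fun σ hσ => ⟨hR99 σ hσ, hRhi σ hσ, hRlo σ hσ⟩⟩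

/-- **Registered sub-goal `stub_pulseGate` of the stub `pulse`** (closed form of
`pulse_gate_radius`): in the gate phase (`w ≥ 1` on `[0, T]`, `B T ≤ 5 log B + 20`) the radius
`R = √((b-β)² + 2w²)` and the clock `u = (b-β)/R` are continuous, differentiable inside with
`|R' + R| ≤ 0.1101 B` and the raw logistic inequality, and `R ∈ [0.99 B, 1.001 B]`,
`R ≥ B - 1/50 - 1.1111 B σ`. [folklore] -/
theorem stub_pulseGate :
    ∀ (b w β f₁ f₂ f₃ R u : ℝ → ℝ) (B q4 φ σ₁ T : ℝ),
      10 ^ 4 ≤ B → 1 ≤ q4 → q4 ≤ 111 / 100 → 0 ≤ φ → φ ≤ 1 / 2000 → σ₁ ≤ 1 / 10 →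
      ContinuousOn b (Icc 0 σ₁) → ContinuousOn w (Icc 0 σ₁) → ContinuousOn β (Icc 0 σ₁) →
      (∀ σ ∈ Ioo 0 σ₁, HasDerivAt b (-(b σ) - (w σ) ^ 2 + f₁ σ) σ) →
      (∀ σ ∈ Ioo 0 σ₁, HasDerivAt w (w σ * (b σ - β σ - 1) + f₂ σ) σ) →
      (∀ σ ∈ Ioo 0 σ₁, HasDerivAt β (-(q4 * β σ) + (w σ) ^ 2 + f₃ σ) σ) →
      (∀ σ ∈ Icc 0 σ₁, |f₁ σ| ≤ φ ∧ |f₂ σ| ≤ φ ∧ |f₃ σ| ≤ φ) → b 0 = B → w 0 = Real.sqrt B / 10 →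
      |β 0| ≤ 1 / 50 → (R = fun s => Real.sqrt ((b s - β s) ^ 2 + 2 * (w s) ^ 2)) →
      (u = fun s => (b s - β s) / R s) → 0 < T → T ≤ σ₁ → B * T ≤ 5 * Real.log B + 20 →
      (∀ σ ∈ Icc 0 T, 1 ≤ w σ) →
      ContinuousOn R (Icc 0 T) ∧ ContinuousOn u (Icc 0 T) ∧
      (∀ s ∈ Ioo 0 T,
        (∃ R' : ℝ, HasDerivAt R R' s ∧ |R' + R s| ≤ 1101 / 10000 * B) ∧
        (∃ u' g : ℝ, HasDerivAt u u' s ∧ |g| ≤ 1101 / 10000 * B ∧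
          u' ≤ -(R s - |g| / R s) * (1 - (u s) ^ 2) + Real.sqrt 2 * |f₂ s| / R s)) ∧
      ∀ σ ∈ Icc 0 T, 99 / 100 * B ≤ R σ ∧ R σ ≤ 1001 / 1000 * B ∧
        B - 1 / 50 - 11111 / 10000 * B * σ ≤ R σ  :=
  fun b w β f₁ f₂ f₃ R u B q4 φ σ₁ T hB hq1 hq2 hφ0 hφ1 hσ₁ hbc hwc hβc hbd hwd hβd hf hb0 hw0 hβ0 hR hu hT0
      hT1 hTB hw1 =>
    pulse_gate_radius b w β f₁ f₂ f₃ R u B q4 φ σ₁ T hB hq1 hq2 hφ0 hφ1 hσ₁ hbc hwc hβc hbd hwd hβd hf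
      hb0 hw0 hβ0 hR hu hT0 hT1 hTB hw1

end Summit.NavierStokesRegularity.NavierStokesRegularity.Theorems.PerpetualPumpAveragedTypeIBlowup

end
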